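import Mathlib
import Literature.NumberTheory.LFunctions.ExceptionalCharacterPrimeValuesQuadraticPolynomial
import Literature.Barriers.RiemannHypothesis.EpsteinZetaRealZeros
import HarnessLib

/-!
# The Kronecker character `χ_D = (D/·)` of a fundamental discriminant as a TERM (odd and even conductors),
# via the Jacobi-symbol character `(·/m)` and `χ_{−4}, χ_{±8}`, identified with its Kronecker values

Topic `Literature/NumberTheory/LFunctions` (sub-namespace `KroneckerCharacter`, naming the object). Typed for the
cell landau-siegel, LS RESCUE PROTOCOL (human ruling D-0124) part (3) «GENUINE BED — explicit real characters /
moduli …» (typer seat ls-rescue-typ-1; referent dictionary rescue/ls-rescue-typ-2/BED-REFERENTS.md v0.1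
`35640c5fbfeb26f1` §E #1: the tree had only `legendreChar p` for PRIME conductor and the value-PREDICATE
`ChamizoJimenezUrroz2021.IsKroneckerChar Δ χ`; a bed list of moduli with composite/even `|Δ|` needs `χ_Δ` as a term).
General constructions; first consumer `Zhang2022/RepairBedModuli.lean`. No claim about Landau–Siegel zeros.

## What is here

* `jacobiChar m : DirichletCharacter ℂ m` — the Jacobi symbol `a ↦ (a/m)` (Mathlib `jacobiSym`) as a
  multiplicative character of `ZMod m` (`jacobiSym.mod_left`, `jacobiSym.eq_zero_iff_not_coprime`);
  `jacobiChar_natCast`, `isQuadratic_jacobiChar` (`m = p` odd prime: the `legendreChar p` pattern).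
* `chiNeg4`, `chi8`, `chiNeg8` — Mathlib's `ZMod.χ₄, χ₈, χ₈'` with values in `ℂ` (conductors `4, 8, 8`).
* **`kroneckerChar D : DirichletCharacter ℂ D.natAbs`** — `χ_D = (D/·)` for a fundamental discriminant `D`, odd
  AND even/composite conductors: write `D = D₂·m*`, `m* ≡ 1 (mod 4)`, `D₂ ∈ {1, −4, 8, −8}`; then
  `χ_D = χ_{D₂}·(·/|m*|)`, each factor lifted to level `|D|` by `DirichletCharacter.changeLevel`. Concretely
  `D ≡ 1 (mod 4)` ↦ `(·/|D|)`; `D ≡ 12 (mod 16)` (`D = 4m`, `m ≡ 3 (4)`) ↦ `χ_{−4}·(·/(|D|/4))`; `D ≡ 8 (mod 16)`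
  (`D = 8m″`) ↦ `χ_{8}·(·/(|D|/8))` if `m″ ≡ 1 (4)`, `χ_{−8}·(·/(|D|/8))` if `m″ ≡ 3 (4)`; junk `1` otherwise.
  `isQuadratic_kroneckerChar`; shape lemmas `kroneckerChar_of_odd / _of_four / _of_eight`.
* **`isKroneckerChar_kroneckerChar`** (PROVED): for every fundamental discriminant `D` (tree predicate
  `IsFundamentalDiscriminant`), `kroneckerChar D` satisfies `IsKroneckerChar D` — value `(D/p)` at every odd prime
  `p` (Jacobi reciprocity, the sign of `D` absorbed by `(−1/p) = χ₄(p)`; `(2/p) = χ₈(p)`, `χ₈' = χ₄χ₈`) and the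
  Kronecker value at `2`. Values at the primes determine a Dirichlet character, so this certifies the term.
  No `instance`, no notation; primitivity (`conductor = |D|`) is not proved here (the bed consumes VALUES).

## References

* H. L. Montgomery, R. C. Vaughan, *Multiplicative Number Theory I* (2007), §9.3 (quadratic characters; the
  Kronecker symbol `(d/n)_K` of a quadratic discriminant `d` is a quadratic character mod `|d|`).
  [cite: MontgomeryVaughan2007, §9.3]
* Tree: `ChamizoJimenezUrroz2021.IsKroneckerChar` (values at the primes, Cox (1.18)).
-/

noncomputable section

open Complex

namespace Literature.NumberTheory.LFunctions.KroneckerCharacter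

open Literature.NumberTheory.LFunctions.ChamizoJimenezUrroz2021 (IsKroneckerChar)
open Literature.Barriers.RiemannHypothesis (IsFundamentalDiscriminant)

/-! ## The Jacobi-symbol character `(·/m)` as a Dirichlet character mod `m` -/

/-- **The Jacobi symbol `(·/m)` as a complex Dirichlet character mod `m`**: `a ↦ (a/m)` (Mathlib's
`jacobiSym`, extended to residues by periodicity in the top argument). For `m = |D|` with `D ≡ 1 (mod 4)` a
fundamental discriminant this IS the Kronecker character `χ_D = (D/·)` (`isKroneckerChar_kroneckerChar_of_odd`);
for `m = p` an odd prime it is the tree's `legendreChar p`. Junk value `1` at `m = 0`.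
[cite: MontgomeryVaughan2007, §9.3] -/
def jacobiChar (m : ℕ) : DirichletCharacter ℂ m :=
  if hm : m = 0 then 1 else
    { toFun := fun a : ZMod m => ((jacobiSym (a.val : ℤ) m : ℤ) : ℂ)
      map_one' := by
        have h1 : ((1 : ZMod m).val : ℤ) = (1 : ℤ) % (m : ℤ) := by
          rw [ZMod.val_one_eq_one_mod, Int.natCast_mod, Nat.cast_one]
        simp only [h1, ← jacobiSym.mod_left, jacobiSym.one_left, Int.cast_one]
      map_mul' := by
        intro a b
        have hab : (((a * b : ZMod m)).val : ℤ) = ((a.val : ℤ) * (b.val : ℤ)) % (m : ℤ) := by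
          rw [ZMod.val_mul, Int.natCast_mod, Nat.cast_mul]
        simp only [hab, ← jacobiSym.mod_left, jacobiSym.mul_left, Int.cast_mul]
      map_nonunit' := by
        intro a ha
        haveI : NeZero m := ⟨hm⟩
        have hcop : ¬ (a.val).Coprime m := by
          rwa [← ZMod.isUnit_iff_coprime, ZMod.natCast_zmod_val]
        have h0 : jacobiSym (a.val : ℤ) m = 0 := by
          rw [jacobiSym.eq_zero_iff_not_coprime, Int.gcd_natCast_natCast]
          exact hcop
        simp only [h0, Int.cast_zero] }

/-- The value of `jacobiChar m` at a residue `a` (`m ≠ 0`): `(a.val / m)`. [cite: MontgomeryVaughan2007, §9.3] -/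
theorem jacobiChar_apply {m : ℕ} [NeZero m] (a : ZMod m) :
    jacobiChar m a = ((jacobiSym (a.val : ℤ) m : ℤ) : ℂ) := by
  rw [jacobiChar, dif_neg (NeZero.ne m)]
  rfl

/-- The value of `jacobiChar m` at a natural number `n` (`m ≠ 0`): the Jacobi symbol `(n/m)`.
[cite: MontgomeryVaughan2007, §9.3] -/
theorem jacobiChar_natCast {m : ℕ} [NeZero m] (n : ℕ) :
    jacobiChar m (n : ZMod m) = ((jacobiSym (n : ℤ) m : ℤ) : ℂ) := by
  rw [jacobiChar_apply, ZMod.val_natCast, Int.natCast_mod, ← jacobiSym.mod_left]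

/-- `jacobiChar m` is a quadratic character (values in `{0, 1, −1}`). [cite: MontgomeryVaughan2007, §9.3] -/
theorem isQuadratic_jacobiChar (m : ℕ) : (jacobiChar m).IsQuadratic := by
  intro a
  by_cases hm : m = 0
  · subst hm
    simp only [jacobiChar, dif_pos]
    by_cases ha : IsUnit a
    · exact Or.inr (Or.inl (MulChar.one_apply ha))
    · exact Or.inl (MulChar.map_nonunit _ ha)
  · haveI : NeZero m := ⟨hm⟩
    rw [jacobiChar_apply]
    rcases jacobiSym.trichotomy (a.val : ℤ) m with h | h | h
    · exact Or.inl (by rw [h, Int.cast_zero])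
    · exact Or.inr (Or.inl (by rw [h, Int.cast_one]))
    · exact Or.inr (Or.inr (by rw [h, Int.cast_neg, Int.cast_one]))

/-! ## Quadratic characters are closed under products and level change -/

/-- A product of two quadratic characters is quadratic. [folklore] -/
private theorem isQuadratic_mul {R R' : Type*} [CommMonoid R] [CommRing R'] {χ ψ : MulChar R R'}
    (hχ : χ.IsQuadratic) (hψ : ψ.IsQuadratic) : (χ * ψ).IsQuadratic := by
  intro a
  rw [MulChar.mul_apply]
  rcases hχ a with h | h | h <;> rcases hψ a with h' | h' | h' <;> simp [h, h']

/-- Level change preserves quadraticity. [folklore] -/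
private theorem isQuadratic_changeLevel {n m : ℕ} (hm : n ∣ m) {χ : DirichletCharacter ℂ n}
    (hχ : χ.IsQuadratic) : (DirichletCharacter.changeLevel hm χ).IsQuadratic := by
  intro a
  by_cases ha : IsUnit a
  · obtain ⟨u, rfl⟩ := ha
    rw [DirichletCharacter.changeLevel_eq_cast_of_dvd]
    exact hχ _
  · exact Or.inl (MulChar.map_nonunit _ ha)

/-! ## The three even prime-power conductors: `χ_{−4}`, `χ_{8}`, `χ_{−8}` -/

/-- `χ_{−4} = (−4/·)`, the character of conductor `4` (Mathlib's `ZMod.χ₄`, values in `ℂ`).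
[cite: MontgomeryVaughan2007, §9.3] -/
def chiNeg4 : DirichletCharacter ℂ 4 := ZMod.χ₄.ringHomComp (Int.castRingHom ℂ)

/-- `χ_{8} = (8/·) = (2/·)`, conductor `8` (Mathlib's `ZMod.χ₈`: `+1` at `±1`, `−1` at `±3 (mod 8)`).
[cite: MontgomeryVaughan2007, §9.3] -/
def chi8 : DirichletCharacter ℂ 8 := ZMod.χ₈.ringHomComp (Int.castRingHom ℂ)

/-- `χ_{−8} = (−8/·) = (−2/·)`, conductor `8` (Mathlib's `ZMod.χ₈'`: `+1` at `1, 3`, `−1` at `5, 7 (mod 8)`).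
[cite: MontgomeryVaughan2007, §9.3] -/
def chiNeg8 : DirichletCharacter ℂ 8 := ZMod.χ₈'.ringHomComp (Int.castRingHom ℂ)

/-! ## The Kronecker character `χ_D` of a fundamental discriminant `D` as a TERM -/

/-- `D ≡ 12 (mod 16)` (i.e. `D = 4m`, `m ≡ 3 (mod 4)`) ⇒ `4 ∣ |D|`. [cite: MontgomeryVaughan2007, §9.3] -/
theorem four_dvd_natAbs {D : ℤ} (h : D % 16 = 12) : 4 ∣ D.natAbs := by
  rw [← Int.natCast_dvd]
  exact Int.dvd_of_emod_eq_zero (by omega)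

/-- `D ≡ 8 (mod 16)` (i.e. `D = 8m`, `m` odd) ⇒ `8 ∣ |D|`. [cite: MontgomeryVaughan2007, §9.3] -/
theorem eight_dvd_natAbs {D : ℤ} (h : D % 16 = 8) : 8 ∣ D.natAbs := by
  rw [← Int.natCast_dvd]
  exact Int.dvd_of_emod_eq_zero (by omega)

/-- **The Kronecker character `χ_D = (D/·)` of a fundamental discriminant `D`, as a Dirichlet character
mod `|D|`** (composite and even `|D|` included). Write `D = D₂ · m*` with `m* ≡ 1 (mod 4)` (odd part, squarefree)
and `D₂ ∈ {1, −4, 8, −8}`; then `χ_D = χ_{D₂} · (·/|m*|)` (Jacobi), each factor lifted to level `|D|`: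
* `D ≡ 1 (mod 4)`: `χ_D = (·/|D|)` (`jacobiChar |D|`);
* `D ≡ 12 (mod 16)` (`D = 4m`, `m ≡ 3 (mod 4)`, `m* = −m`): `χ_D = χ_{−4} · (·/(|D|/4))`;
* `D ≡ 8 (mod 16)` (`D = 8m″`, `m″` odd): `χ_D = χ_{8} · (·/(|D|/8))` if `m″ ≡ 1 (mod 4)`, `χ_{−8} · (·/(|D|/8))`
  if `m″ ≡ 3 (mod 4)`;
* otherwise (not a fundamental discriminant): junk value `1`.
E.g. `χ_{−4} = χ₄`, `χ_{12} = χ₄·(·/3)`, `χ_{−20} = χ₄·(·/5)`, `χ_{24} = χ₈'·(·/3)`, `χ_{−24} = χ₈·(·/3)`,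
`χ_{−1155} = (·/1155)`. The identification with the tree's value-predicate `IsKroneckerChar D` (values `(D/p)` at
the odd primes, Kronecker rule at `2`) is `isKroneckerChar_kroneckerChar` (all three shapes).
[cite: MontgomeryVaughan2007, §9.3] -/
def kroneckerChar (D : ℤ) : DirichletCharacter ℂ D.natAbs :=
  if D % 4 = 1 then jacobiChar D.natAbs
  else if h4 : D % 16 = 12 then
    DirichletCharacter.changeLevel (four_dvd_natAbs h4) chiNeg4 *
      DirichletCharacter.changeLevel (Nat.div_dvd_of_dvd (four_dvd_natAbs h4)) (jacobiChar (D.natAbs / 4))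
  else if h8 : D % 16 = 8 then
    DirichletCharacter.changeLevel (eight_dvd_natAbs h8) (if D / 8 % 4 = 1 then chi8 else chiNeg8) *
      DirichletCharacter.changeLevel (Nat.div_dvd_of_dvd (eight_dvd_natAbs h8)) (jacobiChar (D.natAbs / 8))
  else 1

/-- For `D ≡ 1 (mod 4)`, `χ_D` is the Jacobi character `(·/|D|)`. [cite: MontgomeryVaughan2007, §9.3] -/
theorem kroneckerChar_of_odd {D : ℤ} (h : D % 4 = 1) : kroneckerChar D = jacobiChar D.natAbs := by
  rw [kroneckerChar, if_pos h]

/-- `χ_D` is a quadratic character for every `D`. [cite: MontgomeryVaughan2007, §9.3] -/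
theorem isQuadratic_kroneckerChar (D : ℤ) : (kroneckerChar D).IsQuadratic := by
  unfold kroneckerChar
  split_ifs
  · exact isQuadratic_jacobiChar _
  · exact isQuadratic_mul (isQuadratic_changeLevel _ (ZMod.isQuadratic_χ₄.comp _))
      (isQuadratic_changeLevel _ (isQuadratic_jacobiChar _))
  · exact isQuadratic_mul (isQuadratic_changeLevel _ (ZMod.isQuadratic_χ₈.comp _))
      (isQuadratic_changeLevel _ (isQuadratic_jacobiChar _))
  · exact isQuadratic_mul (isQuadratic_changeLevel _ (ZMod.isQuadratic_χ₈'.comp _))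
      (isQuadratic_changeLevel _ (isQuadratic_jacobiChar _))
  · intro a
    by_cases ha : IsUnit a
    · exact Or.inr (Or.inl (MulChar.one_apply ha))
    · exact Or.inl (MulChar.map_nonunit _ ha)


/-! ## Identification with the Kronecker values: the odd case `D ≡ 1 (mod 4)` -/

/-- Reciprocity in the form the Kronecker character needs: for `D ≡ 1 (mod 4)` and odd `p`,
`(p/|D|) = (D/p)`. [cite: MontgomeryVaughan2007, §9.3] -/
theorem jacobiSym_natAbs_eq_of_mod_four {D : ℤ} (h : D % 4 = 1) {p : ℕ} (hp : Odd p) :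
    jacobiSym (p : ℤ) D.natAbs = jacobiSym D p := by
  rcases le_or_gt 0 D with hD | hD
  · -- `D ≥ 0`: `|D| = D ≡ 1 (mod 4)`
    have hcast : ((D.natAbs : ℕ) : ℤ) = D := Int.natAbs_of_nonneg hD
    have ha : D.natAbs % 4 = 1 := by omega
    conv_rhs => rw [← hcast]
    exact (jacobiSym.quadratic_reciprocity_one_mod_four ha hp).symm
  · -- `D < 0`: `|D| = −D ≡ 3 (mod 4)`, `(D/p) = χ₄(p)·(|D|/p)`
    have hcast : ((D.natAbs : ℕ) : ℤ) = -D := Int.ofNat_natAbs_of_nonpos hD.le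
    have ha : D.natAbs % 4 = 3 := by omega
    have hodd : Odd D.natAbs := Nat.odd_iff.mpr (by omega)
    have hD' : D = -((D.natAbs : ℕ) : ℤ) := by omega
    conv_rhs => rw [hD', jacobiSym.neg _ hp]
    rcases Nat.odd_iff.mp hp |> fun h2 => (show p % 4 = 1 ∨ p % 4 = 3 by omega) with hp4 | hp4
    · rw [ZMod.χ₄_nat_one_mod_four hp4, one_mul]
      exact (jacobiSym.quadratic_reciprocity_one_mod_four' hodd hp4).symm
    · rw [ZMod.χ₄_nat_three_mod_four hp4, jacobiSym.quadratic_reciprocity_three_mod_four ha hp4]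
      ring

/-- The Kronecker rule at `2` for odd `D`: `(2/|D|) = +1` if `D ≡ 1 (mod 8)`, `−1` if `D ≡ 5 (mod 8)`.
[cite: MontgomeryVaughan2007, §9.3] -/
theorem jacobiSym_two_natAbs_of_mod_four {D : ℤ} (h : D % 4 = 1) :
    (jacobiSym 2 D.natAbs : ℂ) = if D % 8 = 1 then 1 else if D % 8 = 5 then -1 else 0 := by
  have hodd : Odd D.natAbs := Nat.odd_iff.mpr (by omega)
  rw [jacobiSym.at_two hodd, ZMod.χ₈_nat_eq_if_mod_eight]
  have h2 : D.natAbs % 2 ≠ 0 := by omega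
  rcases (show D % 8 = 1 ∨ D % 8 = 5 by omega) with h8 | h8
  · have : D.natAbs % 8 = 1 ∨ D.natAbs % 8 = 7 := by omega
    simp [h2, this, h8]
  · have : ¬ (D.natAbs % 8 = 1 ∨ D.natAbs % 8 = 7) := by omega
    simp [h2, this, h8]

/-- **`χ_D` has the Kronecker values for odd fundamental `D`**: for `D ≡ 1 (mod 4)`, `kroneckerChar D` satisfies
the tree's `IsKroneckerChar D` — modulus `|D|`, value `(D/p)` at every odd prime `p`, and the Kronecker value at `2`.
(A Dirichlet character is determined by its values at the primes, so this pins `χ_D` down.)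
[cite: MontgomeryVaughan2007, §9.3] -/
theorem isKroneckerChar_kroneckerChar_of_odd {D : ℤ} (h : D % 4 = 1) [NeZero D.natAbs] :
    IsKroneckerChar D (kroneckerChar D) := by
  refine ⟨(Int.natCast_natAbs D), fun p hp hp2 => ?_, ?_⟩
  · rw [kroneckerChar_of_odd h, jacobiChar_natCast,
      jacobiSym_natAbs_eq_of_mod_four h (hp.odd_of_ne_two hp2)]
  · rw [kroneckerChar_of_odd h, show (2 : ZMod D.natAbs) = ((2 : ℕ) : ZMod D.natAbs) from rfl,
      jacobiChar_natCast, Nat.cast_ofNat, jacobiSym_two_natAbs_of_mod_four h]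


/-- Corollary for bed rows: for odd fundamental `D` and an odd prime `p`, `χ_D(p)` IS the Legendre/Jacobi value
`(D/p)`; in particular «`p` inert in `ℚ(√D)`» reads `kroneckerChar D p = −1`. [cite: MontgomeryVaughan2007, §9.3] -/
theorem kroneckerChar_natCast_of_odd {D : ℤ} (h : D % 4 = 1) [NeZero D.natAbs] {p : ℕ} (hp : p.Prime)
    (hp2 : p ≠ 2) : kroneckerChar D (p : ZMod D.natAbs) = ((jacobiSym D p : ℤ) : ℂ) :=
  (isKroneckerChar_kroneckerChar_of_odd h).2.1 p hp hp2

/-! ## Identification with the Kronecker values: the even cases `D = 4m` (`m ≡ 3 (mod 4)`) and `D = 8m″`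
(`D = −4·m*` resp. `±8·m*`, `m* ≡ 1 (mod 4)`: `(D/p) = χ₄(p)·(p/|m*|)` resp. `χ₈(p)·(p/|m*|)` / `χ₈'(p)·(p/|m*|)`
at odd `p ∤ D`; both sides vanish at `p ∣ D` and at `2`) -/

/-- For `D ≡ 12 (mod 16)`, `χ_D = χ_{−4} · (·/(|D|/4))` (both lifted to level `|D|`). [cite: MontgomeryVaughan2007, §9.3] -/
theorem kroneckerChar_of_four {D : ℤ} (h : D % 16 = 12) :
    kroneckerChar D = DirichletCharacter.changeLevel (four_dvd_natAbs h) chiNeg4 *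
      DirichletCharacter.changeLevel (Nat.div_dvd_of_dvd (four_dvd_natAbs h)) (jacobiChar (D.natAbs / 4)) := by
  have h1 : ¬ D % 4 = 1 := by omega
  rw [kroneckerChar, if_neg h1, dif_pos h]

/-- For `D ≡ 8 (mod 16)`, `χ_D = χ_{±8} · (·/(|D|/8))`, the sign `+` iff `D/8 ≡ 1 (mod 4)`.
[cite: MontgomeryVaughan2007, §9.3] -/
theorem kroneckerChar_of_eight {D : ℤ} (h : D % 16 = 8) :
    kroneckerChar D = DirichletCharacter.changeLevel (eight_dvd_natAbs h) (if D / 8 % 4 = 1 then chi8 else chiNeg8) *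
      DirichletCharacter.changeLevel (Nat.div_dvd_of_dvd (eight_dvd_natAbs h)) (jacobiChar (D.natAbs / 8)) := by
  have h1 : ¬ D % 4 = 1 := by omega
  have h2 : ¬ D % 16 = 12 := by omega
  rw [kroneckerChar, if_neg h1, dif_neg h2, dif_pos h]

/-- `(D/p) = 0` at a prime `p ∣ D`. [folklore] -/
private theorem jacobiSym_eq_zero_of_dvd_natAbs {D : ℤ} {p : ℕ} (hp : p.Prime) (hpD : p ∣ D.natAbs) :
    jacobiSym D p = 0 := by
  haveI : NeZero p := ⟨hp.ne_zero⟩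
  rw [jacobiSym.eq_zero_iff_not_coprime, Int.gcd_eq_natAbs, Int.natAbs_natCast, Nat.gcd_eq_right hpD]
  exact hp.one_lt.ne'

/-- At a prime dividing the level every Dirichlet character vanishes, and so does `(D/p)`. [folklore] -/
private theorem apply_prime_eq_zero_of_dvd {D : ℤ} [NeZero D.natAbs] (χ : DirichletCharacter ℂ D.natAbs)
    {p : ℕ} (hp : p.Prime) (hpD : p ∣ D.natAbs) :
    χ (p : ZMod D.natAbs) = ((jacobiSym D p : ℤ) : ℂ) := by
  have hnu : ¬ IsUnit (p : ZMod D.natAbs) := by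
    rw [ZMod.isUnit_prime_iff_not_dvd hp]; exact fun h => h hpD
  rw [MulChar.map_nonunit _ hnu, jacobiSym_eq_zero_of_dvd_natAbs hp hpD, Int.cast_zero]

/-- The lifted factors at an odd prime `p ∤ D`: `(changeLevel _ χ) p = χ p`. [folklore] -/
private theorem changeLevel_natCast_of_not_dvd {n : ℕ} {D : ℤ} (hn : n ∣ D.natAbs)
    (χ : DirichletCharacter ℂ n) {p : ℕ} (hp : p.Prime) (hpD : ¬ p ∣ D.natAbs) :
    DirichletCharacter.changeLevel hn χ (p : ZMod D.natAbs) = χ (p : ZMod n) := by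
  have hcop : IsCoprime (p : ℤ) (D.natAbs : ℤ) :=
    Nat.isCoprime_iff_coprime.mpr ((Nat.Prime.coprime_iff_not_dvd hp).mpr hpD)
  have := DirichletCharacter.changeLevel_eq_cast_of_dvd' χ hn hcop
  simpa only [Int.cast_natCast] using this

/-- `|D|/4 ≠ 0` resp. `|D|/8 ≠ 0` for the even fundamental shapes. [folklore] -/
private theorem natAbs_div_ne_zero {D : ℤ} [NeZero D.natAbs] {k : ℕ} (hk : k ∣ D.natAbs) :
    D.natAbs / k ≠ 0 := fun h0 =>
  (NeZero.ne D.natAbs) (Nat.eq_zero_of_dvd_of_div_eq_zero hk h0)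

/-- **`χ_D` has the Kronecker values for `D = 4m`, `m ≡ 3 (mod 4)`** (`D ≡ 12 (mod 16)`: `D = −4, 12, 28, −20, …`).
[cite: MontgomeryVaughan2007, §9.3] -/
theorem isKroneckerChar_kroneckerChar_of_four {D : ℤ} (h : D % 16 = 12) [NeZero D.natAbs] :
    IsKroneckerChar D (kroneckerChar D) := by
  refine ⟨Int.natCast_natAbs D, fun p hp hp2 => ?_, ?_⟩
  · by_cases hpD : p ∣ D.natAbs
    · exact apply_prime_eq_zero_of_dvd _ hp hpD
    · have hpo : Odd p := hp.odd_of_ne_two hp2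
      haveI : NeZero (D.natAbs / 4) := ⟨natAbs_div_ne_zero (four_dvd_natAbs h)⟩
      rw [kroneckerChar_of_four h, MulChar.mul_apply, changeLevel_natCast_of_not_dvd _ _ hp hpD,
        changeLevel_natCast_of_not_dvd _ _ hp hpD, chiNeg4, MulChar.ringHomComp_apply, jacobiChar_natCast]
      -- integer identity `χ₄(p) · (p / (|D|/4)) = (D/p)`
      set m : ℤ := D / 4 with hm
      have hD : D = 4 * m := by omega
      have hm1 : (-m) % 4 = 1 := by omega
      have hnat : D.natAbs / 4 = (-m).natAbs := by
        rw [Int.natAbs_neg, hm, Int.natAbs_ediv_of_dvd (Int.dvd_of_emod_eq_zero (by omega))]; rfl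
      have key : jacobiSym D p = ZMod.χ₄ p * jacobiSym (p : ℤ) (D.natAbs / 4) := by
        rw [hnat, jacobiSym_natAbs_eq_of_mod_four hm1 hpo, hD, jacobiSym.mul_left,
          jacobiSym.at_four hpo, one_mul, ← jacobiSym.neg _ hpo, neg_neg]
      rw [key, Int.cast_mul]
      simp only [eq_intCast]
  · -- at `2`: `2 ∣ |D|`, both sides vanish (`D ≡ 4 (mod 8)`)
    have h8 : ¬ D % 8 = 1 := by omega
    have h8' : ¬ D % 8 = 5 := by omega
    rw [if_neg h8, if_neg h8']
    have h2 : 2 ∣ D.natAbs := dvd_trans (by norm_num : (2 : ℕ) ∣ 4) (four_dvd_natAbs h)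
    have := apply_prime_eq_zero_of_dvd (kroneckerChar D) Nat.prime_two h2
    rw [Nat.cast_ofNat] at this
    rw [this, jacobiSym_eq_zero_of_dvd_natAbs Nat.prime_two h2, Int.cast_zero]

/-- **`χ_D` has the Kronecker values for `D = 8m″`, `m″` odd** (`D ≡ 8 (mod 16)`: `D = ±8, ±24, 40, …`). [cite: MontgomeryVaughan2007, §9.3] -/
theorem isKroneckerChar_kroneckerChar_of_eight {D : ℤ} (h : D % 16 = 8) [NeZero D.natAbs] :
    IsKroneckerChar D (kroneckerChar D) := by
  refine ⟨Int.natCast_natAbs D, fun p hp hp2 => ?_, ?_⟩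
  · by_cases hpD : p ∣ D.natAbs
    · exact apply_prime_eq_zero_of_dvd _ hp hpD
    · have hpo : Odd p := hp.odd_of_ne_two hp2
      haveI : NeZero (D.natAbs / 8) := ⟨natAbs_div_ne_zero (eight_dvd_natAbs h)⟩
      rw [kroneckerChar_of_eight h, MulChar.mul_apply, changeLevel_natCast_of_not_dvd _ _ hp hpD,
        changeLevel_natCast_of_not_dvd _ _ hp hpD, jacobiChar_natCast]
      set m : ℤ := D / 8 with hm
      have hD : D = 8 * m := by omega
      have hnat8 : D.natAbs / 8 = m.natAbs := by
        rw [hm, Int.natAbs_ediv_of_dvd (Int.dvd_of_emod_eq_zero (by omega))]; rfl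
      -- `(D/p) = χ₈(p)·(m/p)` since `(8/p) = (2/p)(4/p) = χ₈(p)`
      have h8m : jacobiSym D p = ZMod.χ₈ p * jacobiSym m p := by
        rw [hD, jacobiSym.mul_left, show (8 : ℤ) = 2 * 4 by norm_num, jacobiSym.mul_left,
          jacobiSym.at_two hpo, jacobiSym.at_four hpo, mul_one]
      rcases (show m % 4 = 1 ∨ m % 4 = 3 by omega) with hm4 | hm4
      · -- `m ≡ 1 (mod 4)`: `D = 8·m`, factor `χ₈`
        rw [if_pos hm4, chi8, MulChar.ringHomComp_apply, h8m, hnat8,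
          jacobiSym_natAbs_eq_of_mod_four hm4 hpo, Int.cast_mul]
        simp only [eq_intCast]
      · -- `m ≡ 3 (mod 4)`: `D = (−8)·(−m)`, factor `χ₈' = χ₄·χ₈`
        have hm1 : (-m) % 4 = 1 := by omega
        have hnat8' : D.natAbs / 8 = (-m).natAbs := by rw [Int.natAbs_neg]; exact hnat8
        have hchi : ZMod.χ₈' (p : ZMod 8) = ZMod.χ₄ (p : ZMod 4) * ZMod.χ₈ (p : ZMod 8) := by
          have := ZMod.χ₈'_int_eq_χ₄_mul_χ₈ p
          simpa only [Int.cast_natCast] using this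
        have hsq : ZMod.χ₄ (p : ZMod 4) * ZMod.χ₄ (p : ZMod 4) = 1 := by
          have hp1 : p % 2 = 1 := Nat.odd_iff.mp hpo
          rcases (show p % 4 = 1 ∨ p % 4 = 3 by omega) with h4 | h4
          · simp [ZMod.χ₄_nat_one_mod_four h4]
          · simp [ZMod.χ₄_nat_three_mod_four h4]
        rw [if_neg (show ¬ m % 4 = 1 by omega), chiNeg8, MulChar.ringHomComp_apply, h8m, hnat8',
          jacobiSym_natAbs_eq_of_mod_four hm1 hpo, jacobiSym.neg _ hpo, hchi]
        simp only [eq_intCast]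
        push_cast
        have hsqC : ((ZMod.χ₄ (p : ZMod 4) : ℤ) : ℂ) * ((ZMod.χ₄ (p : ZMod 4) : ℤ) : ℂ) = 1 := by
          exact_mod_cast hsq
        linear_combination (((ZMod.χ₈ (p : ZMod 8) : ℤ) : ℂ) * ((jacobiSym m p : ℤ) : ℂ)) * hsqC
  · -- at `2`: `2 ∣ |D|`, both sides vanish (`D ≡ 0 (mod 8)`)
    have h8 : ¬ D % 8 = 1 := by omega
    have h8' : ¬ D % 8 = 5 := by omega
    rw [if_neg h8, if_neg h8']
    have h2 : 2 ∣ D.natAbs := dvd_trans (by norm_num : (2 : ℕ) ∣ 8) (eight_dvd_natAbs h)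
    have := apply_prime_eq_zero_of_dvd (kroneckerChar D) Nat.prime_two h2
    rw [Nat.cast_ofNat] at this
    rw [this, jacobiSym_eq_zero_of_dvd_natAbs Nat.prime_two h2, Int.cast_zero]

/-- **`χ_D` has the Kronecker values for EVERY fundamental discriminant `D`** (odd: `D ≡ 1 (mod 4)`; even:
`D/4 ≡ 3 (mod 4)` or `D/4 ≡ 2 (mod 4)` square-free, i.e. `D ≡ 12` or `8 (mod 16)`). [cite: MontgomeryVaughan2007, §9.3] -/
theorem isKroneckerChar_kroneckerChar {D : ℤ} (hD : IsFundamentalDiscriminant D) [NeZero D.natAbs] :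
    IsKroneckerChar D (kroneckerChar D) := by
  rcases hD with ⟨h1, -, -⟩ | ⟨h4, h23, hsq⟩
  · exact isKroneckerChar_kroneckerChar_of_odd h1
  · rcases h23 with h3 | h3
    · -- `D/4 ≡ 2 (mod 4)`: `D ≡ 8 (mod 16)`
      obtain ⟨k, hk⟩ := h4
      have : D % 16 = 8 := by subst hk; omega
      exact isKroneckerChar_kroneckerChar_of_eight this
    · obtain ⟨k, hk⟩ := h4
      have : D % 16 = 12 := by subst hk; omega
      exact isKroneckerChar_kroneckerChar_of_four this

end Literature.NumberTheory.LFunctions.KroneckerCharacter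

end
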